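import Summits.HubbardSuperconductivity.HubbardSuperconductivity.Theorems.AnisotropyChordTransferFibre3B1Eval
import Summits.HubbardSuperconductivity.HubbardSuperconductivity.Theorems.AnisotropyChordTransferFibre3B1Instances

/-!
# Route `AnisotropyChord` / H0 rotor rung, LEVEL 2 family B1: the exact-integer cell evaluator bounds the real bracket
pieces (lemmas; the assembled soundness theorem `cell_sound` is in `…Fibre3B1EvalSound`)

`…Fibre3B1Eval` defines the kernel-evaluable integers `loSumZ`, `hiSumZ`, the rational `tailConstQ` and the certificate
`cellCheck`.  THIS FILE proves they bound the real objects of the generic bracket: `inWin_iff`/`allWin_iff` (Boolean window tests =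
`zWindow` membership), `sum_Icc_eq_sum_range`/`sum_box_eq_grid`/`sum_idx_eq_grid` + `cast_gridSum` (the `idx`-sum IS the grid
loop), `loTermZ_le` (`⌊D·νdⁿ/Π loDen^{a}⌋ ≤ D·Π(|q|²−ν)^{−a}`, integer floor division), `hiTerm_le_hiTermZ`
(`D·Π(W_{θ₀}(q)−ν)^{−a} ≤ ⌊D(12Tdνd)ⁿ/Π hiDen^{a}⌋ + 1` for `θ₀² ≤ Tn/Td`, `hiDen > 0`), `hiDenPos_spec`,
`tailConst_le_tailConstQ` (`π ≤ 3927/1250 = piHi` via `Real.pi_lt_d4`, monotonicity in `π`).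
Prover seat `hubbard-h0-rotor-p2` g4; helper for piece A = stmt-HubbardSuperconductivity-23918 of rung 19089
(`--supports`, helper class).  Nothing here proves superconductivity in the Hubbard model; helper lemmas of ONE conditional
reduction (the GM₃ ∀L certificate, Level-2 rows); the rotor TARGET as originally worded stays FALSE (g15 verdict).
Mathlib + the tree only; no sorry.
-/

set_option linter.dupNamespace false
set_option autoImplicit false

noncomputable section

open scoped BigOperators

namespace Summit.HubbardSuperconductivity.HubbardSuperconductivity.Theorems.AnisotropyChord.Transfer.Fibre3.B1

/-! ## Boolean window tests -/

/-- `inWin K q ↔ q ∈ zWindow K`. [folklore] -/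
theorem inWin_iff (K : ℕ) (q : ℤ × ℤ) : inWin K q = true ↔ q ∈ zWindow K := by
  unfold inWin
  rw [mem_zWindow_iff]
  simp only [Bool.and_eq_true, decide_eq_true_eq]
  tauto

/-- `allWin K s p ↔ ∀ t, p + s t ∈ zWindow K`. [folklore] -/
theorem allWin_iff (K : ℕ) {m : ℕ} (s : Fin m → ℤ × ℤ) (p : ℤ × ℤ) :
    allWin K s p = true ↔ ∀ t, p + s t ∈ zWindow K := by
  unfold allWin
  rw [List.all_eq_true]
  constructor
  · intro h t
    exact (inWin_iff K _).1 (h t (List.mem_finRange t))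
  · intro h t _
    exact (inWin_iff K _).2 (h t)

/-- an integer pair off the origin has `q₁² + q₂² ≥ 1`. [folklore] -/
theorem one_le_sq_add_sq_int (q : ℤ × ℤ) (hq : q ≠ (0, 0)) : 1 ≤ q.1 ^ 2 + q.2 ^ 2 := by
  obtain ⟨x, y⟩ := q
  simp only [ne_eq, Prod.mk.injEq, not_and] at hq
  simp only
  by_cases hx : x = 0
  · have hy : y ≠ 0 := hq hx
    have : 0 < y ^ 2 := by positivity
    nlinarith [sq_nonneg x]
  · have : 0 < x ^ 2 := by positivity
    nlinarith [sq_nonneg y]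

/-! ## The grid loop is the `idx` sum -/

/-- list sums over `List.range` are `Finset.range` sums (with an integer-to-real cast). [folklore] -/
theorem cast_list_sum_range (f : ℕ → ℤ) (N : ℕ) :
    ((((List.range N).map f).sum : ℤ) : ℝ) = ∑ i ∈ Finset.range N, (f i : ℝ) := by
  induction N with
  | zero => simp
  | succ N ih =>
    rw [List.range_succ, List.map_append, List.sum_append, Finset.sum_range_succ, Int.cast_add, ih]
    simp

/-- the grid loop, cast to `ℝ`, as a double `Finset.range` sum. [folklore] -/
theorem cast_gridSum (M : ℕ) (F : ℤ × ℤ → ℤ) :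
    ((gridSum M F : ℤ) : ℝ)
      = ∑ i ∈ Finset.range (2 * M + 1), ∑ j ∈ Finset.range (2 * M + 1), (F (boxPt M i j) : ℝ) := by
  unfold gridSum
  rw [cast_list_sum_range]
  refine Finset.sum_congr rfl fun i _ => ?_
  rw [cast_list_sum_range]

/-- an integer interval sum as a `Finset.range` sum. [folklore] -/
theorem sum_Icc_eq_sum_range (M : ℕ) (g : ℤ → ℝ) :
    ∑ x ∈ Finset.Icc (-(M : ℤ)) M, g x = ∑ i ∈ Finset.range (2 * M + 1), g ((i : ℤ) - M) := by
  have himg : (Finset.range (2 * M + 1)).image (fun i : ℕ => (i : ℤ) - M) = Finset.Icc (-(M : ℤ)) M := by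
    ext x
    simp only [Finset.mem_image, Finset.mem_range, Finset.mem_Icc]
    constructor
    · rintro ⟨i, hi, rfl⟩
      constructor <;> omega
    · intro hx
      exact ⟨(x + M).toNat, by omega, by omega⟩
  rw [← himg, Finset.sum_image]
  intro i _ j _ h
  have h' : (i : ℤ) = j := by linarith
  exact_mod_cast h'

/-- the box sum as the grid loop. [folklore] -/
theorem sum_box_eq_grid (M : ℕ) (G : ℤ × ℤ → ℝ) :
    ∑ p ∈ box M, G p = ∑ i ∈ Finset.range (2 * M + 1), ∑ j ∈ Finset.range (2 * M + 1), G (boxPt M i j) := by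
  unfold box
  rw [Finset.sum_product, sum_Icc_eq_sum_range M]
  refine Finset.sum_congr rfl fun i _ => ?_
  rw [sum_Icc_eq_sum_range M]
  rfl

/-- the `idx` sum as the grid loop with the Boolean window test. [folklore] -/
theorem sum_idx_eq_grid (K S : ℕ) {m : ℕ} (s : Fin m → ℤ × ℤ) (G : ℤ × ℤ → ℝ) :
    ∑ p ∈ idx K S s, G p
      = ∑ i ∈ Finset.range (2 * (K + S) + 1), ∑ j ∈ Finset.range (2 * (K + S) + 1),
          (if allWin K s (boxPt (K + S) i j) = true then G (boxPt (K + S) i j) else 0) := by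
  classical
  unfold idx
  rw [Finset.sum_filter, sum_box_eq_grid]
  refine Finset.sum_congr rfl fun i _ => Finset.sum_congr rfl fun j _ => ?_
  by_cases h : ∀ t, boxPt (K + S) i j + s t ∈ zWindow K
  · rw [if_pos h, if_pos ((allWin_iff K s _).2 h)]
  · rw [if_neg h, if_neg (mt (allWin_iff K s _).1 h)]

/-- a list product over `Fin m` is the `Finset` product. [folklore] -/
theorem list_prod_finRange {M : Type*} [CommMonoid M] {m : ℕ} (g : Fin m → M) :
    ((List.finRange m).map g).prod = ∏ t, g t := by
  rw [← List.ofFn_eq_map, List.prod_ofFn]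

/-- a list sum over `Fin m` is the `Finset` sum. [folklore] -/
theorem list_sum_finRange {M : Type*} [AddCommMonoid M] {m : ℕ} (g : Fin m → M) :
    ((List.finRange m).map g).sum = ∑ t, g t := by
  rw [← List.ofFn_eq_map, List.sum_ofFn]

/-! ## The lower evaluation -/

/-- the lower factor in integers: `1/(|q|² − νn/νd) = νd/loDen` and `loDen > 0` off the origin (`νn < νd`, `νd > 0`). [folklore] -/
theorem lo_factor_eq (νn νd : ℤ) (hνd : 0 < νd) (hν1 : νn < νd) (q : ℤ × ℤ) (hq : q ≠ (0, 0)) :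
    0 < loDen νn νd q ∧ 1 / (nsq q - (νn : ℝ) / νd) = (νd : ℝ) / (loDen νn νd q : ℝ) := by
  have h1 := one_le_sq_add_sq_int q hq
  have hpos : 0 < loDen νn νd q := by unfold loDen; nlinarith
  refine ⟨hpos, ?_⟩
  have hposR : (0 : ℝ) < (loDen νn νd q : ℝ) := by exact_mod_cast hpos
  have hνdR : (0 : ℝ) < νd := by exact_mod_cast hνd
  unfold loDen at hposR ⊢
  unfold nsq
  push_cast at hposR ⊢
  field_simp

/-- termwise LOWER evaluation: `loTermZ ≤ D·Π_t (|p+s_t|² − ν)^{−a_t}` on the index set, `0` off it. [folklore] -/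
theorem loTermZ_le (νn νd : ℤ) (hνd : 0 < νd) (hν1 : νn < νd) (K : ℕ) {m : ℕ} (s : Fin m → ℤ × ℤ) (a : Fin m → ℕ)
    (n D : ℕ) (hn : ∑ t, a t = n) (p : ℤ × ℤ) :
    ((loTermZ νn νd K s a n D p : ℤ) : ℝ)
      ≤ if allWin K s p = true then (D : ℝ) * ∏ t, (1 / (nsq (p + s t) - (νn : ℝ) / νd)) ^ a t else 0 := by
  unfold loTermZ
  split_ifs with h
  · have hall := (allWin_iff K s p).1 h
    have hfac : ∀ t, 0 < loDen νn νd (p + s t) ∧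
        1 / (nsq (p + s t) - (νn : ℝ) / νd) = (νd : ℝ) / (loDen νn νd (p + s t) : ℝ) :=
      fun t => lo_factor_eq νn νd hνd hν1 _ ((mem_zWindow_iff K _).1 (hall t)).1
    set M : ℤ := ((List.finRange m).map fun t => loDen νn νd (p + s t) ^ a t).prod with hM
    have hMeq : M = ∏ t, loDen νn νd (p + s t) ^ a t := by rw [hM, list_prod_finRange]
    have hMpos : 0 < M := by
      rw [hMeq]
      exact Finset.prod_pos fun t _ => pow_pos (hfac t).1 _
    have hMR : (0 : ℝ) < (M : ℝ) := by exact_mod_cast hMpos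
    -- the real value of the exact quotient
    have hprod : (D : ℝ) * ∏ t, (1 / (nsq (p + s t) - (νn : ℝ) / νd)) ^ a t
        = ((D : ℤ) * νd ^ n : ℤ) / (M : ℝ) := by
      rw [hMeq]
      push_cast
      rw [Finset.prod_congr rfl fun t _ => by rw [(hfac t).2]]
      simp_rw [div_pow]
      rw [Finset.prod_div_distrib, Finset.prod_pow_eq_pow_sum, hn, mul_div_assoc]
    rw [hprod]
    -- integer floor division
    have hdiv := Int.ediv_mul_le ((D : ℤ) * νd ^ n) hMpos.ne'
    rw [le_div_iff₀ hMR]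
    exact_mod_cast hdiv
  · simp

/-- ★ LOWER evaluation: `loSumZ ≤ D · loSum (νn/νd)`. -/
theorem loSumZ_le (νn νd : ℤ) (hνd : 0 < νd) (hν1 : νn < νd) (K S : ℕ) {m : ℕ} (s : Fin m → ℤ × ℤ)
    (a : Fin m → ℕ) (n D : ℕ) (hn : ∑ t, a t = n) :
    ((loSumZ νn νd K S s a n D : ℤ) : ℝ) ≤ (D : ℝ) * loSum ((νn : ℝ) / νd) K S s a := by
  unfold loSumZ loSum
  rw [cast_gridSum, sum_idx_eq_grid, Finset.mul_sum]
  refine Finset.sum_le_sum fun i _ => ?_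
  rw [Finset.mul_sum]
  refine Finset.sum_le_sum fun j _ => ?_
  rw [mul_ite, mul_zero]
  exact loTermZ_le νn νd hνd hν1 K s a n D hn _

/-! ## The upper evaluation -/

/-- `hiDenPos` certifies `hiDen > 0` on the punctured window. [folklore] -/
theorem hiDenPos_spec (νn νd Tn Td : ℤ) (K : ℕ) (h : hiDenPos νn νd Tn Td K = true) (q : ℤ × ℤ)
    (hq : q ∈ zWindow K) : 0 < hiDen νn νd Tn Td q := by
  unfold hiDenPos at h
  rw [List.all_eq_true] at h
  have hq' := (mem_zWindow_iff K q).1 hq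
  obtain ⟨hq0, ⟨h1a, h1b⟩, ⟨h2a, h2b⟩⟩ := hq'
  have hi : (q.1 + K).toNat ∈ List.range (2 * K + 1) := by rw [List.mem_range]; omega
  have hj : (q.2 + K).toNat ∈ List.range (2 * K + 1) := by rw [List.mem_range]; omega
  have h2 := h _ hi
  rw [List.all_eq_true] at h2
  have h3 := h2 _ hj
  have hpt : boxPt K (q.1 + K).toNat (q.2 + K).toNat = q := by
    unfold boxPt
    ext <;> simp only <;> omega
  rw [hpt, Bool.or_eq_true, Bool.not_eq_true', decide_eq_true_eq] at h3
  rcases h3 with h3 | h3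
  · exact absurd ((inWin_iff K q).2 hq) (by rw [h3]; exact Bool.false_ne_true)
  · exact h3

/-- the upper factor in integers: for `θ₀² ≤ Tn/Td`, `Td > 0`, `νd > 0`, `hiDen > 0`:
`0 ≤ 1/(W_{θ₀}(q) − νn/νd) ≤ 12·Td·νd / hiDen`. [folklore] -/
theorem hi_factor_le (νn νd Tn Td : ℤ) (hνd : 0 < νd) (hTd : 0 < Td) (θ0 : ℝ) (hT : θ0 ^ 2 * Td ≤ Tn)
    (q : ℤ × ℤ) (hpos : 0 < hiDen νn νd Tn Td q) :
    0 ≤ 1 / (winE θ0 q - (νn : ℝ) / νd) ∧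
      1 / (winE θ0 q - (νn : ℝ) / νd) ≤ (12 * Td * νd : ℝ) / (hiDen νn νd Tn Td q : ℝ) := by
  have hνdR : (0 : ℝ) < νd := by exact_mod_cast hνd
  have hTdR : (0 : ℝ) < Td := by exact_mod_cast hTd
  have hposR : (0 : ℝ) < (hiDen νn νd Tn Td q : ℝ) := by exact_mod_cast hpos
  -- `W_T(q) − ν = hiDen/(12 Td νd)` with `T = Tn/Td`, and `W_T ≤ W_{θ₀}`
  set WT : ℝ := ((q.1 : ℤ) : ℝ) ^ 2 * (1 - (Tn : ℝ) / Td * ((q.1 : ℤ) : ℝ) ^ 2 / 12)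
      + ((q.2 : ℤ) : ℝ) ^ 2 * (1 - (Tn : ℝ) / Td * ((q.2 : ℤ) : ℝ) ^ 2 / 12) with hWT
  have hWTeq : WT - (νn : ℝ) / νd = (hiDen νn νd Tn Td q : ℝ) / (12 * Td * νd) := by
    rw [hWT]
    unfold hiDen
    push_cast
    field_simp
    ring
  have hWTpos : 0 < WT - (νn : ℝ) / νd := by rw [hWTeq]; positivity
  have hθT : θ0 ^ 2 ≤ (Tn : ℝ) / Td := by rw [le_div_iff₀ hTdR]; exact hT
  have hle : WT ≤ winE θ0 q := by
    rw [hWT]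
    unfold winE
    have h1 : 0 ≤ ((q.1 : ℤ) : ℝ) ^ 2 * ((q.1 : ℤ) : ℝ) ^ 2 := by positivity
    have h2 : 0 ≤ ((q.2 : ℤ) : ℝ) ^ 2 * ((q.2 : ℤ) : ℝ) ^ 2 := by positivity
    nlinarith [mul_le_mul_of_nonneg_left hθT h1, mul_le_mul_of_nonneg_left hθT h2]
  have hWpos : 0 < winE θ0 q - (νn : ℝ) / νd := by linarith
  refine ⟨(div_nonneg zero_le_one hWpos.le), ?_⟩
  calc 1 / (winE θ0 q - (νn : ℝ) / νd) ≤ 1 / (WT - (νn : ℝ) / νd) :=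
        one_div_le_one_div_of_le hWTpos (by linarith)
    _ = (12 * Td * νd : ℝ) / (hiDen νn νd Tn Td q : ℝ) := by
        rw [hWTeq, one_div_div]

/-- termwise UPPER evaluation: `D·Π_t (W_{θ₀}(p+s_t) − ν)^{−a_t} ≤ hiTermZ` on the index set (`0 ≤ 0` off it). [folklore] -/
theorem hiTerm_le_hiTermZ (νn νd Tn Td : ℤ) (hνd : 0 < νd) (hTd : 0 < Td) (θ0 : ℝ) (hT : θ0 ^ 2 * Td ≤ Tn)
    (K : ℕ) (hpos : hiDenPos νn νd Tn Td K = true) {m : ℕ} (s : Fin m → ℤ × ℤ) (a : Fin m → ℕ) (n D : ℕ)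
    (hn : ∑ t, a t = n) (p : ℤ × ℤ) :
    (if allWin K s p = true then (D : ℝ) * ∏ t, (1 / (winE θ0 (p + s t) - (νn : ℝ) / νd)) ^ a t else 0)
      ≤ ((hiTermZ νn νd Tn Td K s a n D p : ℤ) : ℝ) := by
  unfold hiTermZ
  split_ifs with h
  · have hall := (allWin_iff K s p).1 h
    have hden : ∀ t, 0 < hiDen νn νd Tn Td (p + s t) := fun t => hiDenPos_spec νn νd Tn Td K hpos _ (hall t)
    have hfac := fun t => hi_factor_le νn νd Tn Td hνd hTd θ0 hT (p + s t) (hden t)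
    set M : ℤ := ((List.finRange m).map fun t => hiDen νn νd Tn Td (p + s t) ^ a t).prod with hM
    have hMeq : M = ∏ t, hiDen νn νd Tn Td (p + s t) ^ a t := by rw [hM, list_prod_finRange]
    have hMpos : 0 < M := by
      rw [hMeq]
      exact Finset.prod_pos fun t _ => pow_pos (hden t) _
    have hMR : (0 : ℝ) < (M : ℝ) := by exact_mod_cast hMpos
    -- bound the real product by the exact quotient
    have hprod : (D : ℝ) * ∏ t, (1 / (winE θ0 (p + s t) - (νn : ℝ) / νd)) ^ a t
        ≤ ((D : ℤ) * (12 * Td * νd) ^ n : ℤ) / (M : ℝ) := by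
      have hle : ∏ t, (1 / (winE θ0 (p + s t) - (νn : ℝ) / νd)) ^ a t
          ≤ ∏ t, ((12 * Td * νd : ℝ) / (hiDen νn νd Tn Td (p + s t) : ℝ)) ^ a t :=
        Finset.prod_le_prod (fun t _ => pow_nonneg (hfac t).1 _)
          (fun t _ => pow_le_pow_left₀ (hfac t).1 (hfac t).2 _)
      have heq : ∏ t, ((12 * Td * νd : ℝ) / (hiDen νn νd Tn Td (p + s t) : ℝ)) ^ a t
          = ((12 * Td * νd : ℝ)) ^ n / (M : ℝ) := by
        rw [hMeq]
        push_cast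
        simp_rw [div_pow]
        rw [Finset.prod_div_distrib, Finset.prod_pow_eq_pow_sum, hn]
      calc (D : ℝ) * ∏ t, (1 / (winE θ0 (p + s t) - (νn : ℝ) / νd)) ^ a t
          ≤ (D : ℝ) * (((12 * Td * νd : ℝ)) ^ n / (M : ℝ)) := by
            rw [← heq]; exact mul_le_mul_of_nonneg_left hle (by positivity)
        _ = ((D : ℤ) * (12 * Td * νd) ^ n : ℤ) / (M : ℝ) := by push_cast; ring
    -- the integer quotient plus one dominates the exact quotient
    have hdiv := Int.lt_ediv_add_one_mul_self ((D : ℤ) * (12 * Td * νd) ^ n) hMpos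
    have hR : (((D : ℤ) * (12 * Td * νd) ^ n : ℤ) : ℝ) / (M : ℝ)
        ≤ ((((D : ℤ) * (12 * Td * νd) ^ n) / M + 1 : ℤ) : ℝ) := by
      rw [div_le_iff₀ hMR]
      exact_mod_cast hdiv.le
    exact hprod.trans hR
  · simp

/-- ★ UPPER evaluation: `D · hiSum (νn/νd) θ₀ ≤ hiSumZ` for `θ₀²·Td ≤ Tn` and `hiDenPos`. -/
theorem hiSum_le_hiSumZ (νn νd Tn Td : ℤ) (hνd : 0 < νd) (hTd : 0 < Td) (θ0 : ℝ) (hT : θ0 ^ 2 * Td ≤ Tn)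
    (K S : ℕ) (hpos : hiDenPos νn νd Tn Td K = true) {m : ℕ} (s : Fin m → ℤ × ℤ) (a : Fin m → ℕ) (n D : ℕ)
    (hn : ∑ t, a t = n) :
    (D : ℝ) * hiSum ((νn : ℝ) / νd) θ0 K S s a ≤ ((hiSumZ νn νd Tn Td K S s a n D : ℤ) : ℝ) := by
  unfold hiSumZ hiSum
  rw [cast_gridSum, sum_idx_eq_grid, Finset.mul_sum]
  refine Finset.sum_le_sum fun i _ => ?_
  rw [Finset.mul_sum]
  refine Finset.sum_le_sum fun j _ => ?_
  rw [mul_ite, mul_zero]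
  exact hiTerm_le_hiTermZ νn νd Tn Td hνd hTd θ0 hT K hpos s a n D hn _

/-! ## The tail constant -/

/-- ★ `tailConst ν K' n ≤ tailConstQ` for `ν = νn/νd ≥ 0` with `ν·piHi²/4 < 1`, `K' ≥ 2`
(every occurrence of `π` in `tailConst` is increasing). [folklore] -/
theorem tailConst_le_tailConstQ (νn νd : ℤ) (hνd : 0 < νd) (hν0 : 0 ≤ νn) (hc : (νn : ℚ) / νd * piHi ^ 2 < 4)
    (K' n : ℕ) (hK' : 2 ≤ K') :
    tailConst ((νn : ℝ) / νd) K' n ≤ ((tailConstQ νn νd K' n : ℚ) : ℝ) := by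
  have hpi := Real.pi_pos
  have hpi3 := Real.pi_gt_three
  have hP : Real.pi ≤ ((piHi : ℚ) : ℝ) := by
    have e : ((piHi : ℚ) : ℝ) = 3.1416 := by unfold piHi; norm_num
    rw [e]
    exact Real.pi_lt_d4.le
  set P : ℝ := ((piHi : ℚ) : ℝ) with hPdef
  have hνR : (0 : ℝ) ≤ (νn : ℝ) / νd := by
    have : (0 : ℝ) < νd := by exact_mod_cast hνd
    have : (0 : ℝ) ≤ νn := by exact_mod_cast hν0
    positivity
  have hcR : (νn : ℝ) / νd * P ^ 2 < 4 := by
    rw [hPdef]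
    exact_mod_cast hc
  have hK'R : (2 : ℝ) ≤ K' := by exact_mod_cast hK'
  have hcc : (νn : ℝ) / νd * Real.pi ^ 2 / 4 ≤ (νn : ℝ) / νd * P ^ 2 / 4 := by
    have : Real.pi ^ 2 ≤ P ^ 2 := pow_le_pow_left₀ hpi.le hP 2
    have := mul_le_mul_of_nonneg_left this hνR
    linarith
  have hD1 : 0 < ((K' : ℝ) + 1) ^ 2 - (νn : ℝ) / νd * P ^ 2 / 4 := by nlinarith
  have hD2 : 0 < (K' : ℝ) ^ 2 - (νn : ℝ) / νd * P ^ 2 / 4 := by nlinarith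
  have e : ((tailConstQ νn νd K' n : ℚ) : ℝ)
      = (P ^ 2 / 4) ^ n * P
          / ((((K' : ℝ) + 1) ^ 2 - (νn : ℝ) / νd * P ^ 2 / 4) ^ (n - 2)
              * ((K' : ℝ) ^ 2 - (νn : ℝ) / νd * P ^ 2 / 4)) := by
    rw [hPdef]
    unfold tailConstQ
    push_cast
    ring
  rw [e]
  unfold tailConst
  have hP0 : 0 < P := lt_of_lt_of_le hpi hP
  apply div_le_div₀ (mul_nonneg (pow_nonneg (div_nonneg (sq_nonneg P) (by norm_num)) n) hP0.le)
  · -- numerator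
    apply mul_le_mul _ hP hpi.le (by positivity)
    exact pow_le_pow_left₀ (by positivity) (by nlinarith [pow_le_pow_left₀ hpi.le hP 2]) _
  · exact mul_pos (pow_pos hD1 _) hD2
  · -- denominator
    apply mul_le_mul _ (by linarith) hD2.le (pow_nonneg (by nlinarith) _)
    exact pow_le_pow_left₀ hD1.le (by linarith) _

end Summit.HubbardSuperconductivity.HubbardSuperconductivity.Theorems.AnisotropyChord.Transfer.Fibre3.B1

end
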